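import Literature.Geometry.Lorentzian.KissingBallsCutMass
import HarnessLib

/-!
# The round sections of the light cone of Minkowski spacetime: cone placement and generators

Stub `stub_minkowskiConeSection` (S1) of the sanity tier of the line `birth` for the crux
`HorizonlessMustDrain` of route `BondiDrainDispersal` (item stmt-FinalStateConjecture-9976,
`Summit.FinalStateConjecture.FinalStateConjecture.Theses.BondiDrainDispersal`).

In the Minkowski development `Literature.Geometry.Lorentzian.Minkowski.vacuumCauchyDevelopment`
of the trivial datum `(ℝ³, δ, 0)` (carrier `E4`, metric `η`, time orientation `∂ₜ`), for `r > 0`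
and a unit vector `y ∈ S² ⊆ ℝ³`:

* the round section point `(r, r y)` lies on the future light cone
  `∂J⁺({0}) = frontier J⁺({0})` of the origin: `J⁺(0) = {x | ‖x̲‖ ≤ x⁰}`
  (`Minkowski.causalFuture_singleton`, O'Neill 1983, Ch. 14, p. 402), the point lies in this
  closed solid cone (`‖r y‖ = r`), and the points `(r + t, r y)`, `t < 0`, outside the cone tend
  to it, so it is not an interior point;
* the outgoing null line `t ↦ (r + t, (r + t) y) = (r, r y) + t (1, y)` is a geodesic of `η` on
  `(-r, r)` — straight lines are geodesics of a metric with constant components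
  (`ModelSpace.isGeodesic_line`, O'Neill 1983, Ch. 3, Example 3.25) — with velocity `(1, y)` at
  `t = 0` (`ModelSpace.velocity_line`).

The metric, time orientation, topology and Levi-Civita connection of
`Minkowski.vacuumCauchyDevelopment.toCauchyDevelopment` are those of `Minkowski.smoothMetric` on
`E4` by `rfl`, which is how the `E4`-level lemmas below are transported to the statement.

## References

* B. O'Neill, *Semi-Riemannian geometry with applications to relativity*, Academic Press 1983,
  Ch. 3, Example 3.25 (geodesics of `ℝⁿᵥ` are straight lines); Ch. 14, p. 402 (`J⁺(p)` in
  Minkowski space).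
* S. W. Hawking, G. F. R. Ellis, *The large scale structure of space-time*, CUP 1973, §5.1.
-/

-- D-0017: single-problem summit, namespace `Summit.FinalStateConjecture.FinalStateConjecture.…`
-- by design; the Summits library sets this option in the lakefile, a standalone check does not.
set_option linter.dupNamespace false

noncomputable section

open Set Filter Metric
open scoped Manifold ContDiff Topology

open Literature.Geometry.Lorentzian

namespace Summit.FinalStateConjecture.FinalStateConjecture.Theorems
namespace BondiDrainDispersalHorizonlessMustDrain

namespace StubMinkowskiConeSection

/-- **The causal future of the origin of the Minkowski development is the closed solid light
cone** `J⁺({0}) = {x | ‖x̲‖ ≤ x⁰}` (`Minkowski.causalFuture_singleton` at `p = 0`, transported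
along the definitional equalities `vacuumCauchyDevelopment.toSpacetime = spacetime`,
`spacetime.metric = η`). O'Neill 1983, Ch. 14, p. 402. -/
theorem causalFuture_origin :
    (Minkowski.vacuumCauchyDevelopment.toCauchyDevelopment.metric.causalFuture
        Minkowski.vacuumCauchyDevelopment.toCauchyDevelopment.timeOrientation {(0 : E4)} :
        Set E4) = {q : E4 | ‖E4.spatial q‖ ≤ q 0} := by
  ext q
  have h := Set.ext_iff.mp (Minkowski.causalFuture_singleton (0 : E4)) q
  simp only [mem_setOf_eq, map_zero, sub_zero, PiLp.zero_apply] at h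
  exact h

/-- **A point `(r, z)` with `‖z‖ = r` lies on the frontier of the solid cone `{x | ‖x̲‖ ≤ x⁰}`
of `E4`**: it lies in the cone, and the points `(r + t, z)`, `t < 0`, of its complement tend to
it as `t ↑ 0`. Elementary topology of `ℝ⁴`; O'Neill 1983, Ch. 14, p. 402 (the null cone is the
boundary of `J⁺(p)`). -/
theorem ofTimeSpace_mem_frontier_solidCone {r : ℝ} {z : E3} (hz : ‖z‖ = r) :
    E4.ofTimeSpace r z ∈ frontier {q : E4 | ‖E4.spatial q‖ ≤ q 0} := by
  rw [frontier_eq_closure_inter_closure]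
  refine ⟨subset_closure ?_, ?_⟩
  · show ‖E4.spatial (E4.ofTimeSpace r z)‖ ≤ E4.ofTimeSpace r z 0
    rw [E4.spatial_ofTimeSpace, E4.ofTimeSpace_apply_zero, hz]
  · -- approach along the vertical line `t ↦ (r, z) + t (1, 0)` from `t < 0`
    have hcont :
        Continuous fun t : ℝ ↦ E4.ofTimeSpace r z + t • E4.ofTimeSpace 1 (0 : E3) := by
      fun_prop
    have htend : Tendsto (fun t : ℝ ↦ E4.ofTimeSpace r z + t • E4.ofTimeSpace 1 (0 : E3))
        (𝓝[<] 0) (𝓝 (E4.ofTimeSpace r z)) := by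
      have h := hcont.tendsto 0
      simp only [zero_smul, add_zero] at h
      exact h.mono_left nhdsWithin_le_nhds
    refine mem_closure_of_tendsto htend (eventually_nhdsWithin_of_forall fun t ht ↦ ?_)
    have ht' : t < 0 := ht
    show ¬ (‖E4.spatial (E4.ofTimeSpace r z + t • E4.ofTimeSpace 1 (0 : E3))‖ ≤
      (E4.ofTimeSpace r z + t • E4.ofTimeSpace 1 (0 : E3)) 0)
    rw [map_add, map_smul, E4.spatial_ofTimeSpace, E4.spatial_ofTimeSpace, smul_zero, add_zero,
      hz, PiLp.add_apply, PiLp.smul_apply, E4.ofTimeSpace_apply_zero, E4.ofTimeSpace_apply_zero,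
      smul_eq_mul, mul_one, not_le]
    linarith

/-- **The round section point `(r, r y)`, `r > 0`, `‖y‖ = 1`, lies on the future light cone
`∂J⁺({0}) = frontier J⁺({0})` of the origin of the Minkowski development.** O'Neill 1983,
Ch. 14, p. 402; Hawking–Ellis 1973, §5.1. -/
theorem ofTimeSpace_mem_frontier_causalFuture {r : ℝ} (hr : 0 < r)
    (y : sphere (0 : E3) 1) :
    E4.ofTimeSpace r (r • (y : E3)) ∈
      frontier (Minkowski.vacuumCauchyDevelopment.toCauchyDevelopment.metric.causalFuture
        Minkowski.vacuumCauchyDevelopment.toCauchyDevelopment.timeOrientation {(0 : E4)}) := by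
  have hy : ‖(y : E3)‖ = 1 := mem_sphere_zero_iff_norm.mp y.2
  have hz : ‖r • (y : E3)‖ = r := by
    rw [norm_smul, Real.norm_eq_abs, abs_of_pos hr, hy, mul_one]
  rw [causalFuture_origin]
  exact ofTimeSpace_mem_frontier_solidCone hz

/-- **The outgoing null line through `(r, r y)` is a straight line**:
`(r + t, (r + t) y) = (r, r y) + t (1, y)` componentwise. -/
theorem line_eq (r : ℝ) (y : E3) :
    (fun t : ℝ ↦ E4.ofTimeSpace (r + t) ((r + t) • y)) =
      fun t : ℝ ↦ E4.ofTimeSpace r (r • y) + t • E4.ofTimeSpace 1 y := by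
  funext t
  ext i
  refine Fin.cases ?_ (fun j ↦ ?_) i
  · simp
  · simp [add_mul]

/-- **The outgoing null line `t ↦ (r + t, (r + t) y)` is a geodesic of the Minkowski development
on `(-r, r)`**: it is the straight line `(r, r y) + t (1, y)`, and straight lines are geodesics of
the Levi-Civita connection of `η`, whose components are constant (`ModelSpace.isGeodesic_line`,
`Minkowski.smoothMetric_val`); the connection of `vacuumCauchyDevelopment.toCauchyDevelopment`
is that of `Minkowski.smoothMetric` by `rfl`. O'Neill 1983, Ch. 3, Example 3.25. -/
theorem isGeodesicOn_line (r : ℝ) (y : E3) :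
    IsGeodesicOn
      (haveI := Minkowski.vacuumCauchyDevelopment.toCauchyDevelopment.metric
          |>.toPseudoRiemannianMetric.hasLeviCivita
       Minkowski.vacuumCauchyDevelopment.toCauchyDevelopment.metric.leviCivita)
      (fun t : ℝ ↦ E4.ofTimeSpace (r + t) ((r + t) • y)) (Ioo (-r) r) := by
  rw [line_eq]
  haveI := Minkowski.smoothMetric.toPseudoRiemannianMetric.hasLeviCivita
  have hline : IsGeodesic Minkowski.smoothMetric.toPseudoRiemannianMetric.leviCivita
      (fun s : ℝ ↦ E4.ofTimeSpace r (r • y) + s • E4.ofTimeSpace 1 y) :=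
    ModelSpace.isGeodesic_line Minkowski.smoothMetric_val _ _
  exact hline.isGeodesicOn _

/-- **The velocity of the outgoing null line `t ↦ (r + t, (r + t) y)` at `t = 0` is `(1, y)`**
(`ModelSpace.velocity_line` for the straight line `(r, r y) + t (1, y)`;
`𝓡 (3 + 1) = 𝓘(ℝ, E4)` by `rfl`). O'Neill 1983, Ch. 3, Example 3.25. -/
theorem velocity_line (r : ℝ) (y : E3) :
    velocity (𝓡 (3 + 1)) (fun t : ℝ ↦ E4.ofTimeSpace (r + t) ((r + t) • y)) 0 =
      E4.ofTimeSpace 1 y := by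
  rw [line_eq]
  exact ModelSpace.velocity_line _ _ 0

end StubMinkowskiConeSection

/-- **S1 — CONE PLACEMENT AND GENERATORS.** For `r > 0` and `y ∈ S²`, the point `(r, r y)` lies
on the future null cone `∂J⁺({0}) = frontier J⁺({0})` of the origin of the Minkowski development
(`Minkowski.causalFuture_singleton`: `J⁺(0) = {‖x̲‖ ≤ x⁰}`), and the outgoing null line
`t ↦ (r + t, (r + t) y)` is a geodesic of `η` on `(-r, r)` (straight lines,
`ModelSpace.isGeodesic_line`) with velocity `(1, y)` at `t = 0` (`ModelSpace.velocity_line`).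
O'Neill 1983, Ch. 3, Example 3.25; Ch. 14, p. 402; Hawking–Ellis 1973, §5.1. -/
theorem stub_minkowskiConeSection : open scoped Manifold in
    ∀ r : ℝ, 0 < r → ∀ y : Metric.sphere (0 : Literature.Geometry.Lorentzian.E3) 1,
      Literature.Geometry.Lorentzian.E4.ofTimeSpace r (r • (y : Literature.Geometry.Lorentzian.E3)) ∈
          frontier (Literature.Geometry.Lorentzian.Minkowski.vacuumCauchyDevelopment.toCauchyDevelopment.metric.causalFuture
            Literature.Geometry.Lorentzian.Minkowski.vacuumCauchyDevelopment.toCauchyDevelopment.timeOrientation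
            {(0 : Literature.Geometry.Lorentzian.E4)}) ∧
        Literature.Geometry.Lorentzian.IsGeodesicOn
            (haveI := Literature.Geometry.Lorentzian.Minkowski.vacuumCauchyDevelopment.toCauchyDevelopment.metric.toPseudoRiemannianMetric.hasLeviCivita
             Literature.Geometry.Lorentzian.Minkowski.vacuumCauchyDevelopment.toCauchyDevelopment.metric.leviCivita)
            (fun t : ℝ ↦ Literature.Geometry.Lorentzian.E4.ofTimeSpace (r + t)
              ((r + t) • (y : Literature.Geometry.Lorentzian.E3)))
            (Set.Ioo (-r) r) ∧
        Literature.Geometry.Lorentzian.velocity (𝓡 (3 + 1))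
            (fun t : ℝ ↦ Literature.Geometry.Lorentzian.E4.ofTimeSpace (r + t)
              ((r + t) • (y : Literature.Geometry.Lorentzian.E3))) 0 =
          Literature.Geometry.Lorentzian.E4.ofTimeSpace 1 (y : Literature.Geometry.Lorentzian.E3) := by
  intro r hr y
  exact ⟨StubMinkowskiConeSection.ofTimeSpace_mem_frontier_causalFuture hr y,
    StubMinkowskiConeSection.isGeodesicOn_line r (y : Literature.Geometry.Lorentzian.E3),
    StubMinkowskiConeSection.velocity_line r (y : Literature.Geometry.Lorentzian.E3)⟩

end BondiDrainDispersalHorizonlessMustDrain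
end Summit.FinalStateConjecture.FinalStateConjecture.Theorems

end
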